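import Literature.AnabelianGeometry.EtaleTheta.Discharge.Sec1Rmk164ZHatForm
import Literature.AnabelianGeometry.EtaleTheta.ThetaSettingUnitsCongruenceClosed
import HarnessLib

/-!
# [EtTh] Remark 1.6.4 (c2) in `Ẑ`-form, EXACT, with the unit-class closedness clause DISCHARGED (every setting)

S. Mochizuki, *The étale theta function …*, Publ. RIMS **45** (2009) [EtTh], Remark 1.6.4 (PRIMS pp. 252–253):
«… a set of classes `O^×_K̈ · (η̈^Θ)^∧ ∈ H¹(Π_{Ÿ^∧}, Δ_Θ)` on which any `Π_X/Π_{Y^∧} ≅ Ẑ ∋ a` acts via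
`(η̈^Θ)^∧ ↦ (η̈^Θ)^∧ − 2a·log(Ü) − (a²/2)·log(q_X) + log(O^×_K̈)`» [cite: MochizukiEtTh2009, Rmk 1.6.4 pp.252-253].

abc-iut cell, prover abc-iut-f-142 (gen 9), consumer knit of key (α′) (abc-iut-L2-lead R1398) on abc-iut-f-128's (Z5b)
`Discharge/Sec1Rmk164ZHatForm` (`HatTheta.rmk164_c2_zhat`: the EXACT `Ẑ`-form under ONE displayed clause `hU` «the unit
classes `infl(Û(u))`, `u ∈ O^×_K̈`, are congruence-closed»).  PROOF-ONLY (no definition, no instance, no Prop-valued fact):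
* `HatTheta.hU_of_comap_eq` — **the clause `hU` HOLDS** for every unit-class function `Û : K̈ˣ → H¹(((Π^tp_Ÿ)^Θ)^∧, Δ_Θ)`
  characterised on `O^×_K̈` by its pull-backs along `ι` — `ι^*(Û(u)) = ι_*(κ(u))`, `κ = kumYdd ∘ toKddHat` the Kummer
  map of an `EtaleThetaData` (exactly the binder `hUh` of abc-iut-f-128's `rmk164_c2_zhat_congr_of_prop15iii`): by
  injectivity of `ι^*` (abc-iut-w6-d081/abc-iut-f-128 `comap_ι_injective`) `Û|_{O^×}` is a homomorphism, and by
  abc-iut-f-142's `ThetaSetting.exists_eq_of_forall_exists_rep_congr_unitsOKdd` (p519088: `O^×_K̈` is compact and its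
  `n`-th powers contain open subgroups, for every theta setting) the range of `infl ∘ Û|_{O^×}` is congruence-closed;
* `HatTheta.rmk164_c2_zhat_of_prop15iii` — **(c2) in `Ẑ`-form, EXACT, for EVERY `σ̂ ∈ Π_X`, from `Prop15iii` and the
  hat-class characterisations alone** (no closedness clause): `σ̂·infl(x̂) = infl(x̂)·infl(L̂)^(−2â)·infl(Q̂)^(−â²)·infl(Û(u))`
  for some `u ∈ O^×_K̈`, `â = toZHat σ̂` — abc-iut-f-128's `rmk164_c2_zhat` with `hZ` from abc-iut-w6-d081's
  `rmk164_c2_int` and `hU` from `hU_of_comap_eq`.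
HONEST FRAMING: `Prop15iii` and the EXISTENCE of the hat classes `x̂, L̂, Q̂, Û(u)` with the stated pull-backs remain
DISPLAYED hypotheses (inhabited under `IsProfiniteCompletion ιYdd`, abc-iut-f-128 p504039); classical bookkeeping under
OUR kernel check; nothing here bears on [IUTchIII] Cor. 3.12; no side taken; typed ≠ proved.
-/

noncomputable section

namespace Literature.AnabelianGeometry.EtaleTheta

open scoped IsMulCommutative
open Literature.AnabelianGeometry.SemiGraphs

namespace ThetaSetting.HatTheta

variable {p : ℕ} [Fact p.Prime] {D : ThetaSetting p} (T : D.HatTheta)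

/-- **The unit-class closedness clause `hU` of `rmk164_c2_zhat` HOLDS** for every unit-class function `Û` characterised
on `O^×_K̈` by `ι^*(Û(u)) = ι_*(kumYdd(toKddHat u))`: a class of `H¹(Π_{Ÿ^∧}, Δ_Θ)` congruent modulo every open normal
`N ⊴ ((Π^tp_X)^Θ)^∧` to some `infl(Û(u_N))`, `u_N ∈ O^×_K̈`, IS `infl(Û(u))` for some `u ∈ O^×_K̈`.  (`Û|_{O^×}` is a
homomorphism by injectivity of `ι^*`; `O^×_K̈` is compact with `n`-th powers containing open subgroups, p519088; the
range of a homomorphism from such a group into a profinite-coefficient `H¹` is congruence-closed, p517305.)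
[cite: MochizukiEtTh2009, Rmk 1.6.4 pp.252-253] [cite: NeukirchSchmidtWingberg2008, I §2 and II §7] -/
theorem hU_of_comap_eq [T.DeltaThetaHat.Normal] [T.GhatThetaYdd.Normal] [D.GtpYddHat.Normal]
    (E : D.EtaleThetaData) (Uh : (↥D.Kdd)ˣ → T.H1ThetaHat T.GhatThetaYdd)
    (hUh : ∀ u ∈ D.unitsOKdd,
      ContH1.comap (MonoidHom.id T.GhatTheta) T.DeltaThetaHat T.ι.toMonoidHom T.ι.continuous
          T.map_ι_gtpYddTheta_le_ghatThetaYdd (Uh u) =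
        ContH1.mapCoeff (MonoidHom.id D.GtpTheta) D.DeltaTheta T.ι.toMonoidHom T.ι.continuous T.DeltaThetaHat
          le_rfl (D.GtpYdd.map D.toTheta) (E.kumYdd (E.toKddHat u)))
    (y : T.H1Hat D.GtpYddHat)
    (hy : ∀ N : OpenNormalSubgroup T.GhatTheta, ∃ u ∈ D.unitsOKdd,
      ∃ f g : contCocycles T.toThetaHat.toMonoidHom T.DeltaThetaHat D.GtpYddHat,
        (QuotientGroup.mk f : T.H1Hat D.GtpYddHat) = y ∧
          (QuotientGroup.mk g : T.H1Hat D.GtpYddHat) = T.inflThetaHat (Uh u) ∧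
          ∀ h : D.GtpYddHat,
            ((f.1 h : T.DeltaThetaHat) : T.GhatTheta) * (((g.1 h : T.DeltaThetaHat) : T.GhatTheta))⁻¹ ∈
              N.toSubgroup) :
    ∃ u ∈ D.unitsOKdd, y = T.inflThetaHat (Uh u) := by
  -- `Û|_{O^×}` is a homomorphism: its pull-backs along `ι` are, and `ι^*` is injective
  have hinj := T.comap_ι_injective
  let κ : D.unitsOKdd →* T.H1ThetaHat T.GhatThetaYdd :=
    { toFun := fun u => Uh u
      map_one' := hinj (by
        have h1 := hUh _ (1 : D.unitsOKdd).2
        rw [OneMemClass.coe_one, map_one, map_one, map_one] at h1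
        rw [map_one]
        exact h1)
      map_mul' := fun a b => hinj (by
        have hab := hUh _ (a * b).2
        rw [Subgroup.coe_mul, map_mul, map_mul, map_mul] at hab
        rw [map_mul, hUh _ a.2, hUh _ b.2]
        exact hab) }
  have hκ : ∀ u : D.unitsOKdd, T.inflThetaHat.comp κ u = T.inflThetaHat (Uh u) := fun _ => rfl
  obtain ⟨u, hu⟩ := D.exists_eq_of_forall_exists_rep_congr_unitsOKdd T.isClosed_deltaThetaHat
    (T.inflThetaHat.comp κ) y (fun N => by
      obtain ⟨u, hu, f, g, hf, hg, hfg⟩ := hy N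
      exact ⟨⟨u, hu⟩, f, g, hf, hg, hfg⟩)
  exact ⟨u, u.2, hu⟩

/-- **[EtTh] Rmk 1.6.4 (c2) in `Ẑ`-form, EXACT, for EVERY `σ̂ ∈ Π_X` — from `Prop15iii` and the hat-class
characterisations, with NO closedness clause** (`CompactSpace ι(Δ_Θ)` is abc-iut-f-128's THEOREM `compactSpace_deltaThetaHat`,
taken as an instance argument exactly as in `rmk164_c2_zhat`): for `x ∈ O^×_K̈·η̈^Θ` (its Θ-class `x′`) and hat classes `x̂, L̂, Q̂, Û(u)`
pulled back along `ι` to `ι_* x′`, `ι_* log(Ü)`, `ι_* kum(q̈)`, `ι_* kum(u)` (`u ∈ O^×_K̈`): for every `σ̂ ∈ Π_X`,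
`â := toZHat σ̂`, there is `u ∈ O^×_K̈` with
`σ̂·infl(x̂) = infl(x̂) · infl(L̂)^(−2â) · infl(Q̂)^(−â²) · infl(Û(u))` in `H¹(Π_{Ÿ^∧}, Δ_Θ)` («`(η̈^Θ)^∧ ↦ (η̈^Θ)^∧ − 2a·log(Ü) −
(a²/2)·log(q_X) + log(O^×_K̈)`» for `a ∈ Ẑ`).  abc-iut-f-128's `rmk164_c2_zhat` with `hZ` from abc-iut-w6-d081's `rmk164_c2_int`
and `hU` from `hU_of_comap_eq`. [cite: MochizukiEtTh2009, Rmk 1.6.4 pp.252-253] -/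
theorem rmk164_c2_zhat_of_prop15iii [T.DeltaThetaHat.Normal] [T.GhatThetaYdd.Normal] [D.GtpYddHat.Normal]
    [CompactSpace T.DeltaThetaHat] (hC : D.Compat) (E : D.EtaleThetaData) (h15 : Prop15iii E hC)
    {x : D.H1 D.GtpYdd} (hx : x ∈ E.thetaClasses) :
    ∃ x' : D.H1Theta (D.GtpYdd.map D.toTheta), D.inflTheta D.GtpYdd x' = x ∧
      ∀ (xh Lh Qh : T.H1ThetaHat T.GhatThetaYdd) (Uh : (↥D.Kdd)ˣ → T.H1ThetaHat T.GhatThetaYdd),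
        ContH1.comap (MonoidHom.id T.GhatTheta) T.DeltaThetaHat T.ι.toMonoidHom T.ι.continuous
            T.map_ι_gtpYddTheta_le_ghatThetaYdd xh =
          ContH1.mapCoeff (MonoidHom.id D.GtpTheta) D.DeltaTheta T.ι.toMonoidHom T.ι.continuous T.DeltaThetaHat le_rfl
            (D.GtpYdd.map D.toTheta) x' →
        ContH1.comap (MonoidHom.id T.GhatTheta) T.DeltaThetaHat T.ι.toMonoidHom T.ι.continuous
            T.map_ι_gtpYddTheta_le_ghatThetaYdd Lh =
          ContH1.mapCoeff (MonoidHom.id D.GtpTheta) D.DeltaTheta T.ι.toMonoidHom T.ι.continuous T.DeltaThetaHat le_rfl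
            (D.GtpYdd.map D.toTheta) E.logUdd →
        ContH1.comap (MonoidHom.id T.GhatTheta) T.DeltaThetaHat T.ι.toMonoidHom T.ι.continuous
            T.map_ι_gtpYddTheta_le_ghatThetaYdd Qh =
          ContH1.mapCoeff (MonoidHom.id D.GtpTheta) D.DeltaTheta T.ι.toMonoidHom T.ι.continuous T.DeltaThetaHat le_rfl
            (D.GtpYdd.map D.toTheta) (E.kumYdd (E.toKddHat D.qddUnit)) →
        (∀ u ∈ D.unitsOKdd,
          ContH1.comap (MonoidHom.id T.GhatTheta) T.DeltaThetaHat T.ι.toMonoidHom T.ι.continuous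
              T.map_ι_gtpYddTheta_le_ghatThetaYdd (Uh u) =
            ContH1.mapCoeff (MonoidHom.id D.GtpTheta) D.DeltaTheta T.ι.toMonoidHom T.ι.continuous T.DeltaThetaHat
              le_rfl (D.GtpYdd.map D.toTheta) (E.kumYdd (E.toKddHat u))) →
        ∀ σh : D.PiHat, ∃ u ∈ D.unitsOKdd,
          ContH1.conj T.toThetaHat.toMonoidHom T.DeltaThetaHat σh (T.inflThetaHat xh) =
            T.inflThetaHat xh
              * ContH1.zhatPow T.toThetaHat.toMonoidHom T.DeltaThetaHat D.GtpYddHat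
                  (D.toZHat σh * D.toZHat σh)⁻¹ (T.inflThetaHat Lh)
              * ContH1.zhatPow T.toThetaHat.toMonoidHom T.DeltaThetaHat D.GtpYddHat
                  (ProfiniteZHatPow.powZHat (D.toZHat σh) (D.toZHat σh))⁻¹ (T.inflThetaHat Qh)
              * T.inflThetaHat (Uh u) := by
  obtain ⟨x', hx', hall⟩ := T.rmk164_c2_int hC E h15 hx
  refine ⟨x', hx', fun xh Lh Qh Uh hxh hLh hQh hUh σh => ?_⟩
  refine T.rmk164_c2_zhat xh Lh Qh Uh (fun σ => ?_) (T.hU_of_comap_eq E Uh hUh) σh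
  obtain ⟨u, hu, hσ⟩ := hall xh Lh Qh hxh hLh hQh σ
  exact ⟨u, hu, hσ (Uh u) (hUh u hu)⟩

end ThetaSetting.HatTheta

end Literature.AnabelianGeometry.EtaleTheta

end
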